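import Summits.QuantumFields.BalabanUV.T4Continuum.Support.ShellMeasureWilsonRealizedSU2Words
import Summits.QuantumFields.BalabanUV.T4Continuum.Support.ShellMeasureWilsonMoving

/-!
# `T4Continuum.ShellMeasureLevelZeroWords` — the LEVEL-0 LEVEL DATA of END-II in kernel form: admissible sectioned
# words are graded words moving linearly, the (AN-bound)₀ witness of a word of exponentials of ray-linear generators,
# and continuity of the cell's sectioned plaquette words in the chart point
# (cell `pub-balaban`, sub-cell `t4`, spine estimate NE7c (node U5b); crew row S11 of the claim table
# `t4/b2b-balaban-t4-ne7c-p1/LEAVES-NE7c-P1.md`, seat `t4-ne7c-formalise-leaf-09`, file 1 of 2 (file 2: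
# `ShellMeasureRootCompositionLevelZero`); ADDITIVE — imports `ShellMeasureWilsonRealizedSU2Words` (p206536) and
# `ShellMeasureWilsonMoving` (p205971) only; 0 `def`, 0 sorry)

HONEST FRAMING.  Finite four-torus programme, rung (B)+1 only — NOT infinite volume, NOT a mass gap, NOT the Clay
problem, NOT summit progress; (B), `BetaPertHyp`, (B^μ) not consumed.  Nothing of Bałaban's inductive levels `j ≥ 1`
is touched: these are the three [folklore] facts that let the LEVEL-0 objects of the cell (words of exponentials of the
skew-Hermitian, real-linear chart generators with frozen unitary exterior letters — `ShellMeasureWilsonRealizedSU2Words`)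
inhabit the binder SHAPES of END-II (`ShellMeasureRootCompositionSU2.slotAC_realized_su2_of_levelData`): `hGW`
(graded `MLetter` words of `ShellMeasureWilsonMoving`), `hAN` ((AN-bound): an analytic–bounded plaquette functional
along the complexified contraction) and `hcont`.  No estimate of the programme; (M1) NOT PRINTED, NOT moved; NE7c NOT
proved; 0/9 spine.  HONEST DEPENDENCY (cell): continuum YM on T⁴ ⇐ BetaPertH ∧ nine spine estimates (0/9 proved);
BetaPertH ⇐ (D1) ∧ (D4) ∧ CAP+tail; G-an2-4 gates asym, D1 and NE2/3/4.

## What is proved ([folklore]; no def)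

* §1 `exists_graded_of_word`: an admissible `Letter` word (generic complete normed `ℂ`-algebra `A`, trace datum `T`)
  IS a graded `MLetter` word moving LINEARLY — `gen Y ↦ moving (c ↦ c•Y)` with size and Lipschitz constant `‖Y‖`,
  `frozen a ↦ frozen a` — with `sSum = lSum = sGen`, `mdFro = dFro` and the same evaluation at every contraction `c`
  (the reading «`L̄ = s̄`» of `ShellMeasureLevelAssembly` at level 0).
* §1 `classifierWitness_linear`: for generators `Y₁ … Y_ℓ` and any radius `Rad`, `f = plaquetteFn [w ↦ w•Y_i]`
  (`T4ShellMeasurePlaquette`) is complex differentiable on `‖w‖ < Rad`, bounded there by `e^{Rad·Σ‖Y_i‖} − 1`, flat at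
  `0`, and equals `exp(cY₁)⋯exp(cY_ℓ) − 1` at real `c ∈ [0,1]` (`normSum_map_smul`).
* §2 `continuous_gen`, `continuous_exp_M₂`, `continuous_letter_eval`, `continuous_wordEval_plaqWord`: the sectioned
  plaquette word `wordEval c (plaqWord Λ e V x p)` is continuous in the chart point `x`.
-/

noncomputable section

open NormedSpace Set Function Metric

namespace Summit.QuantumFields.BalabanUV.T4Continuum.ShellMeasureLevelZeroWords

open scoped Matrix.Norms.L2Operator
open Literature.MathematicalPhysics.QuantumLattice (quatMatrix continuous_quatMatrix)
open Literature.MathematicalPhysics.QuantumFieldTheory.Balaban1983to89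
open T4CubeChartGnomonic (SU2)
open T4HaarSU2ExpChart (imQuat continuous_imQuat)
open T4CubeChartExp (toE)
open T4ShellMeasurePlaquette (plaquetteFn differentiableOn_plaquetteFn plaquetteFn_apply_zero plaquetteFn_eq)
open ShellMeasureWilsonWords (scale normSum wordExp normSum_nonneg norm_real_smul norm_wordExp_sub_one_le)
open ShellMeasureWilsonTrace (Letter wordEval sGen dFro TraceData)
open ShellMeasureWilsonMoving (MLetter mwordEval mdFro sSum lSum)
open ShellMeasureWilsonRealizedSU2 (M₂ gen letter plaqWord)

/-! ## §1 Graded words moving linearly; the (AN-bound)₀ witness -/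

section LevelZeroData

variable {A : Type*} [NormedRing A] [NormedAlgebra ℂ A] [CompleteSpace A] [NormOneClass A]

omit [CompleteSpace A] [NormOneClass A] in
/-- **AN ADMISSIBLE SECTIONED WORD IS A GRADED WORD MOVING LINEARLY.**  Every `Letter` word admissible for the trace
datum (`gen Y`: `τ Y = 0`, contracting exponentials; `frozen a`: `‖a‖ ≤ 1`) is, letter by letter, a graded `MLetter`
word — `gen Y ↦ moving (c ↦ c•Y)` with size AND Lipschitz constant `‖Y‖`, `frozen a ↦ frozen a` with `0, 0` — with
`s = L = sGen`, frozen deviation `dFro`, and the same evaluation at every contraction `c` (the level-0 reading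
«`L̄ = s̄`» of `ShellMeasureLevelAssembly`). [folklore] -/
theorem exists_graded_of_word (T : TraceData A) : ∀ (w : List (Letter A)), (∀ ℓ ∈ w, ℓ.Good T.τ) →
    ∃ gw : List (MLetter A × ℝ × ℝ), (∀ y ∈ gw, y.1.Good T.τ y.2.1 y.2.2) ∧ sSum gw = sGen w ∧ lSum gw = sGen w ∧
      mdFro (gw.map Prod.fst) = dFro w ∧ ∀ c : ℝ, mwordEval c (gw.map Prod.fst) = wordEval c w
  | [], _ => ⟨[], by simp, by simp, by simp, by simp, fun c => by simp⟩
  | Letter.frozen a :: w, h => by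
    obtain ⟨gw, hg, hs, hl, hd, hev⟩ := exists_graded_of_word T w fun ℓ hℓ => h ℓ (List.mem_cons_of_mem _ hℓ)
    have ha : (Letter.frozen a).Good T.τ := h _ (by simp)
    refine ⟨(MLetter.frozen a, 0, 0) :: gw, ?_, ?_, ?_, ?_, fun c => ?_⟩
    · intro y hy
      rcases List.mem_cons.1 hy with rfl | hy
      · exact ⟨ha, le_rfl, le_rfl⟩
      · exact hg y hy
    · simp [hs, Letter.genNorm]
    · simp [hl, Letter.genNorm]
    · simp [hd, MLetter.dev, Letter.dev]
    · simp [hev c, MLetter.eval]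
  | Letter.gen Y :: w, h => by
    obtain ⟨gw, hg, hs, hl, hd, hev⟩ := exists_graded_of_word T w fun ℓ hℓ => h ℓ (List.mem_cons_of_mem _ hℓ)
    have hY : (Letter.gen Y).Good T.τ := h _ (by simp)
    refine ⟨(MLetter.moving fun c : ℝ => (c : ℂ) • Y, ‖Y‖, ‖Y‖) :: gw, ?_, ?_, ?_, ?_, fun c => ?_⟩
    · intro y hy
      rcases List.mem_cons.1 hy with rfl | hy
      · refine ⟨norm_nonneg Y, norm_nonneg Y, fun c hc0 hc1 => ⟨?_, hY.2 c hc0 hc1, ?_, ?_⟩⟩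
        · rw [T.map_smul, hY.1, mul_zero]
        · rw [norm_real_smul hc0]
          exact mul_le_of_le_one_left (norm_nonneg Y) hc1
        · have h1c : 0 ≤ 1 - c := by linarith
          rw [← sub_smul, ← Complex.ofReal_sub, norm_real_smul h1c]
      · exact hg y hy
    · simp [hs, Letter.genNorm]
    · simp [hl, Letter.genNorm]
    · simp [hd, MLetter.dev, Letter.dev]
    · simp [hev c, MLetter.eval]

omit [CompleteSpace A] [NormOneClass A] in
/-- `Σ‖w•Y_i‖ = ‖w‖·Σ‖Y_i‖` for a complex scalar. [folklore] -/
theorem normSum_map_smul (l : List A) (w : ℂ) :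
    normSum (l.map fun Y => w • Y) = ‖w‖ * normSum l := by
  induction l with
  | nil => simp
  | cons Y l ih => simp [ih, norm_smul, mul_add]

omit [NormOneClass A] in
/-- **THE (AN-bound)₀ WITNESS OF A WORD OF EXPONENTIALS OF RAY-LINEAR GENERATORS.**  For generators `Y₁, …, Y_ℓ` the
plaquette functional of the LINEAR complexified bond rays `w ↦ w•Y_i`, `f = plaquetteFn [w ↦ w•Y_i]`
(`T4ShellMeasurePlaquette`), is complex differentiable on `‖w‖ < Rad`, bounded there by `e^{Rad·Σ‖Y_i‖} − 1`, flat at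
`0`, and restricts on `[0,1]` to `c ↦ exp(cY₁)⋯exp(cY_ℓ) − 1` — the datum asked by END-II's binder `hAN` at level 0,
with NO analytic input. [folklore] -/
theorem classifierWitness_linear (l : List A) (Rad : ℝ) :
    ∃ f : ℂ → A, DifferentiableOn ℂ f (ball 0 Rad) ∧
      (∀ w ∈ ball (0 : ℂ) Rad, ‖f w‖ ≤ Real.exp (Rad * normSum l) - 1) ∧ f 0 = 0 ∧
      ∀ c : ℝ, 0 ≤ c → c ≤ 1 → f (c : ℂ) = wordExp (scale c l) - 1 := by
  have hmap : ∀ w : ℂ, ((l.map fun Y => fun w : ℂ => w • Y).map fun X => X w) = l.map fun Y => w • Y := fun w => by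
    rw [List.map_map]; rfl
  refine ⟨plaquetteFn (l.map fun Y => fun w : ℂ => w • Y), differentiableOn_plaquetteFn fun X hX => ?_,
    fun w hw => ?_, plaquetteFn_apply_zero fun X hX => ?_, fun c _ _ => ?_⟩
  · obtain ⟨Y, -, rfl⟩ := List.mem_map.1 hX
    exact differentiableOn_id.smul_const Y
  · rw [plaquetteFn_eq, hmap w]
    have h1 := norm_wordExp_sub_one_le (l.map fun Y => w • Y)
    have h2 : normSum (l.map fun Y => w • Y) ≤ Rad * normSum l := by
      rw [normSum_map_smul]
      exact mul_le_mul_of_nonneg_right (le_of_lt (mem_ball_zero_iff.1 hw)) (normSum_nonneg l)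
    unfold wordExp at h1
    exact h1.trans (by gcongr)
  · obtain ⟨Y, -, rfl⟩ := List.mem_map.1 hX
    exact zero_smul ℂ Y
  · rw [plaquetteFn_eq, hmap (c : ℂ)]
    rfl

end LevelZeroData

/-! ## §2 Continuity of the sectioned plaquette words in the chart point -/

section Continuity

variable {P : Params} {j : ℕ} [DecidableEq (PBond P j)] (Λ : Finset (PBond P j)) {n : ℕ} (e : ↥Λ × Fin 3 ≃ Fin n)

omit [DecidableEq (PBond P j)] in
/-- the chart generator of a block bond is continuous in the chart point (it is real-linear). [folklore] -/
theorem continuous_gen (b : ↥Λ) : Continuous fun x : Fin n → ℝ => gen Λ e b x := by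
  have h : (fun x : Fin n → ℝ => gen Λ e b x) = fun x => quatMatrix (imQuat (toE fun i => x (e (b, i)))) := rfl
  rw [h]
  exact continuous_quatMatrix.comp (continuous_imQuat.comp
    ((PiLp.continuous_toLp 2 _).comp (continuous_pi fun i => continuous_apply _)))

/-- the matrix exponential on `M₂(ℂ)` is continuous (entire). [folklore] -/
theorem continuous_exp_M₂ : Continuous (exp : M₂ → M₂) :=
  continuous_iff_continuousAt.2 fun x => (NormedSpace.exp_analytic (𝕂 := ℂ) x).continuousAt

/-- every letter of a sectioned word, evaluated at a fixed contraction, is continuous in the chart point. [folklore] -/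
theorem continuous_letter_eval (V : GaugeField P j SU2) (b : PBond P j) (inv : Bool) (c : ℝ) :
    Continuous fun x : Fin n → ℝ => (letter Λ e V x b inv).eval c := by
  unfold letter
  by_cases hb : b ∈ Λ
  · simp only [dif_pos hb]
    cases inv
    · simp only [Bool.false_eq_true, ↓reduceIte, Letter.eval_gen]
      exact continuous_exp_M₂.comp ((continuous_gen Λ e ⟨b, hb⟩).const_smul (c : ℂ))
    · simp only [↓reduceIte, Letter.eval_gen, smul_neg]
      exact continuous_exp_M₂.comp (((continuous_gen Λ e ⟨b, hb⟩).const_smul (c : ℂ)).neg)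
  · simp only [dif_neg hb]
    cases inv <;> simp only [Bool.false_eq_true, ↓reduceIte, Letter.eval_frozen] <;> exact continuous_const

/-- **THE SECTIONED PLAQUETTE WORD IS CONTINUOUS IN THE CHART POINT** (so the level-0 `hol V p` meets END-II's
`hcont`). [folklore] -/
theorem continuous_wordEval_plaqWord (V : GaugeField P j SU2) (p : Plaq P j) (c : ℝ) :
    Continuous fun x : Fin n → ℝ => wordEval c (plaqWord Λ e V x p) := by
  have hl := fun (b : PBond P j) (inv : Bool) => continuous_letter_eval Λ e V b inv c
  unfold plaqWord
  simp only [ShellMeasureWilsonTrace.wordEval_cons, ShellMeasureWilsonTrace.wordEval_nil]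
  exact (hl ⟨p.src, p.μ⟩ false).mul ((hl ⟨p.src.shift p.μ, p.ν⟩ false).mul
    ((hl ⟨p.src.shift p.ν, p.μ⟩ true).mul ((hl ⟨p.src, p.ν⟩ true).mul continuous_const)))

end Continuity

end Summit.QuantumFields.BalabanUV.T4Continuum.ShellMeasureLevelZeroWords
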